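import Summits.NavierStokesRegularity.NavierStokesRegularity.Theses.TypeICertificateLadder
import Summits.NavierStokesRegularity.NavierStokesRegularity.Theorems.TypeICertificateLadderTargetRateClassLiouville
import Summits.NavierStokesRegularity.NavierStokesRegularity.Theorems.TypeICertificateLadderTargetTwistedHeadIdentity
import Summits.NavierStokesRegularity.NavierStokesRegularity.Theorems.TypeICertificateLadderTargetRotatingConjugateDensity
import Summits.NavierStokesRegularity.NavierStokesRegularity.Theorems.TypeICertificateLadderTargetSolitonLaws
import Summits.NavierStokesRegularity.NavierStokesRegularity.Theorems.TypeICertificateLadderTargetWeightedGapLemma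
import Literature.Analysis.FluidPDE.PineauVicolRSSHolds
import HarnessLib

/-!
# Crux `NoTypeIBlowup` (stmt-NavierStokesRegularity-1217), line `killing-twisted-bernoulli-solitons`:
  the REDUCTION carried by the line (sorry-free content of the skeleton)

Lead prover `prover-line-stmt-NavierStokesRegularity-1217-1` (gen 1), 2026-08-16. The line's four
provable stubs are LANDED — B1 `stub_twistedHeadIdentity` (p97091), B2 `stub_rotatingConjugateDensity`
(p105556), B3 `stub_solitonLaws` (p101267), B4 `stub_weightedGapLemma` (p100133) — and the two
extreme rotation regimes of Pineau–Vicol's Theorem 1.4 are the tree theorem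
`pineauVicol2026_rss_liouville_holds`. What the line leaves OPEN is recorded here as explicit
hypotheses of kernel-checked reductions (no definitions; both hypotheses spelled inline, verbatim the
registered stub signatures `stub_windowLiouville` (B5b) and `stub_solitonSelection` (A2') of the
skeleton `Cruxes/Target/Lines/killing_twisted_bernoulli_solitons.lean`):

* `rssLiouville_of_windowLiouville` : WINDOW LIOUVILLE (B5b: Type-I RSS solitons with rotation rate
  in a compact window `a₀ ≤ |α| ≤ A₀`, equipped with a rotating conjugate density obeying the soliton
  law and identity, are trivial — Pineau–Vicol Conj. 1.1 at `α ≈ 1`, OPEN) ⟹ Liouville for ALL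
  Type-I rotated self-similar solutions of Pineau–Vicol's class (their Conj. 1.1 in full): the
  tree's Thm 1.4 takes `|α| < α₁ ∨ |α| > α₂`, the landed B2–B4 take `4α² ≤ ε₀(C₀)`, and B5b is
  called only on the residual window `[√ε₀/2, α₂]`.
* `noTypeIBlowup_of_solitonSelection_of_windowLiouville` : SOLITON SELECTION (A2': a non-trivial
  element of the Oseen-gauge rate class `IsTypeIAncientMild C` forces a non-trivial Type-I RSS
  soliton — OPEN, external, crux-strength) ∧ WINDOW LIOUVILLE ⟹ `NoTypeIBlowup`, through the landed
  rate-class reduction `noTypeIBlowup_of_rateClassLiouville` (p94280, which contains the landed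
  Type-I zoom `stub_typeIZoom`, p87903).

CONDITIONAL on the two open hypotheses; it does not close the item. Lands `--supports
stmt-NavierStokesRegularity-1217` under the registered names.
-/

noncomputable section

namespace Summit.NavierStokesRegularity.NavierStokesRegularity.Theorems

open MeasureTheory Set
open scoped RealInnerProductSpace Laplacian
open Literature.Analysis.FluidPDE

/-- **Pineau–Vicol's Conjecture 1.1 in their class, from WINDOW LIOUVILLE alone.** If Type-I rotated
self-similar solitons with rotation rate in every compact window `0 < a₀ ≤ |α| ≤ A₀`, carrying a
rotating conjugate density (`C²`, positive, normalised, Gaussian bounds `c e^{−7|y|²/16} ≤ m ≤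
M₁ e^{−|y|²/16}`, Gaussian gradient bound, kernel of the adjoint of `L_α = −Δ + (U + ½y − αJy)·∇`)
which obeys the soliton law `∫|curl U|² m ≤ 4α²` and identity `∫|curl U|² m = 2α∫(curl U)₂ m`, are
trivial, then EVERY classical Type-I (`‖u(t,x)‖ ≤ C₀/(‖x‖+√−t)`) rotated self-similar solution on
`[−1,0)` with a `C²` profile has `U = 0`, for every `α`. Proof: `|α| < α₁(C₀)` or `|α| > α₂(C₀)` is
Pineau–Vicol's Theorem 1.4 (`pineauVicol2026_rss_liouville_holds`); otherwise the landed stubs give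
the conjugate density (B2, `stub_rotatingConjugateDensity`, with `A := |α|`), the law and identity
(B3 fed with B1), and the gap threshold `ε₀(C₀,c,M₁)` (B4); `4α² ≤ ε₀` is closed by B4, and the
residual window `√ε₀/2 ≤ |α| ≤ α₂` by the hypothesis. [cite: PineauVicol2026, Theorem 1.4 and Conjecture 1.1 (arXiv:2607.09619 p. 4)] -/
theorem rssLiouville_of_windowLiouville :
    (∀ C₀ : ℝ, 0 < C₀ → ∀ a₀ A₀ : ℝ, 0 < a₀ → a₀ ≤ A₀ → ∀ α : ℝ, a₀ ≤ |α| → |α| ≤ A₀ → ∀ (u : ℝ → EuclideanSpace ℝ (Fin 3) → EuclideanSpace ℝ (Fin 3)) (p : ℝ → EuclideanSpace ℝ (Fin 3) → ℝ) (U : EuclideanSpace ℝ (Fin 3) → EuclideanSpace ℝ (Fin 3)) (m : EuclideanSpace ℝ (Fin 3) → ℝ) (c M₁ : ℝ), Literature.Analysis.FluidPDE.IsClassicalNSSolutionOn (Set.Ico (-1) 0) 1 0 u p → (∀ t ∈ Set.Ico (-1 : ℝ) 0, ∀ x : EuclideanSpace ℝ (Fin 3), ‖u t x‖ ≤ C₀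 / (‖x‖ + Real.sqrt (-t))) → ContDiff ℝ 2 U → (∀ t ∈ Set.Ico (-1 : ℝ) 0, ∀ x : EuclideanSpace ℝ (Fin 3), u t x = Literature.Analysis.FluidPDE.pvAnsatz α (fun y _ => U y) t x) → 0 < c → 0 < M₁ → (ContDiff ℝ 2 m ∧ (∀ y, 0 < m y) ∧ (∫ y, m y = 1) ∧ (∀ y, c * Real.exp (-(7 / 16 : ℝ) * ‖y‖ ^ 2) ≤ m y) ∧ (∀ y, m y ≤ M₁ * Real.exp (-(1 / 16 : ℝ) * ‖y‖ ^ 2)) ∧ (∃ M₂ : ℝ, ∀ y, ‖fderiv ℝ m y‖ ≤ M₂ * Real.exp (-(1 / 32 : ℝ) * ‖y‖ ^ 2)) ∧ (∀ y, Laplacian.laplacian m y + Literature.Analysis.FluidPDE.VectorCalculus.divergence (fun z => m z • (U z + (1 / 2 : ℝ) • z - α • Literature.Analysis.FluidPDE.rotGen z)) y = 0)) → (∫ y, ‖Literature.Analysis.FluidPDE.curl U y‖ ^ 2 * m y ≤ 4 * α ^ 2) → (∫ y, ‖Literature.Analysis.FluidPDE.curl U y‖ ^ 2 * m y = 2 *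 α * ∫ y, (Literature.Analysis.FluidPDE.curl U y) 2 * m y) → U = 0) → ∀ C₀ : ℝ, 0 < C₀ → ∀ (α : ℝ) (u : ℝ → EuclideanSpace ℝ (Fin 3) → EuclideanSpace ℝ (Fin 3)) (p : ℝ → EuclideanSpace ℝ (Fin 3) → ℝ) (U : EuclideanSpace ℝ (Fin 3) → EuclideanSpace ℝ (Fin 3)), Literature.Analysis.FluidPDE.IsClassicalNSSolutionOn (Set.Ico (-1) 0) 1 0 u p → (∀ t ∈ Set.Ico (-1 : ℝ) 0, ∀ x : EuclideanSpace ℝ (Fin 3), ‖u t x‖ ≤ C₀ / (‖x‖ + Real.sqrt (-t))) → ContDiff ℝ 2 U → (∀ t ∈ Set.Ico (-1 : ℝ) 0, ∀ x : EuclideanSpace ℝ (Fin 3), u t x = Literature.Analysis.FluidPDE.pvAnsatz α (fun y _ => U y) t x) → U = 0 := by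
  intro h5 C₀ hC₀ α u p U hns hI hU hA
  obtain ⟨α₁, α₂, _hα₁, _hα₂, hPV⟩ := pineauVicol2026_rss_liouville_holds C₀ hC₀
  by_cases hext : |α| < α₁ ∨ α₂ < |α|
  · exact hPV α u p U hns hI hU hA hext
  have hαle : |α| ≤ α₂ := le_of_not_gt fun h => hext (Or.inr h)
  obtain ⟨c, M₁, hc, hM₁, hdens⟩ := stub_rotatingConjugateDensity C₀ hC₀ |α| (abs_nonneg α)
  obtain ⟨m, hm⟩ := hdens α u p U le_rfl hns hI hU hA
  obtain ⟨hlaw, hid⟩ := stub_solitonLaws stub_twistedHeadIdentity C₀ α u p U m c M₁ hns hI hU hA hm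
  obtain ⟨ε₀, hε₀, hgap⟩ := stub_weightedGapLemma C₀ hC₀ c M₁ hc hM₁
  by_cases hsmall : 4 * α ^ 2 ≤ ε₀
  · exact hgap α u p U m hns hI hU hA hm (hlaw.trans hsmall)
  · have hlt : ε₀ < 4 * α ^ 2 := lt_of_not_ge hsmall
    have ha₀ : 0 < Real.sqrt ε₀ / 2 := by positivity
    have hle : Real.sqrt ε₀ / 2 ≤ |α| := by
      have e₁ : Real.sqrt ε₀ ≤ Real.sqrt (4 * α ^ 2) := Real.sqrt_le_sqrt hlt.le
      have e₂ : Real.sqrt (4 * α ^ 2) = 2 * |α| := by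
        rw [show (4 : ℝ) * α ^ 2 = (2 * |α|) ^ 2 by rw [mul_pow, sq_abs]; norm_num]
        exact Real.sqrt_sq (by positivity)
      linarith
    exact h5 C₀ hC₀ (Real.sqrt ε₀ / 2) α₂ ha₀ (hle.trans hαle) α hle hαle u p U m c M₁ hns hI hU hA
      hc hM₁ hm hlaw hid

/-- **`NoTypeIBlowup` from SOLITON SELECTION and WINDOW LIOUVILLE** (the two open stubs of the line,
as hypotheses; everything else is landed). If (A2') every non-trivial element of the Oseen-gauge
Type-I rate class `IsTypeIAncientMild C`, `C > 0`, forces a non-trivial Type-I rotated self-similar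
soliton of Pineau–Vicol's class, and (B5b) window Liouville holds, then no classical Leray–Hopf
solution from a rapidly decaying datum blows up at the Type-I rate: the rate class is trivial by
`rssLiouville_of_windowLiouville` and contradiction, and the landed reduction
`noTypeIBlowup_of_rateClassLiouville` (Type-I zoom at Leray points + the route's ladder glue)
concludes the crux BY NAME. CONDITIONAL; does not close the item. [cite: PineauVicol2026, Conjecture 1.1 (arXiv:2607.09619 p. 4); KNSS2009, §6] -/
theorem noTypeIBlowup_of_solitonSelection_of_windowLiouville :
    (∀ (C : ℝ), 0 < C → ∀ (v : ℝ → EuclideanSpace ℝ (Fin 3) → EuclideanSpace ℝ (Fin 3)), Literature.Analysis.FluidPDE.IsTypeIAncientMild C v → ¬ (∀ t < 0, ∀ x, v t x = 0) → ∃ C₀ : ℝ, 0 < C₀ ∧ ∃ (α : ℝ) (u : ℝ → EuclideanSpace ℝ (Fin 3) → EuclideanSpace ℝ (Fin 3)) (p : ℝ → EuclideanSpace ℝ (Fin 3) → ℝ) (U : EuclideanSpace ℝ (Fin 3) → EuclideanSpace ℝ (Fin 3)), Literature.Analysis.FluidPDE.IsClassicalNSSolutionOn (Set.Ico (-1) 0)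 1 0 u p ∧ (∀ t ∈ Set.Ico (-1 : ℝ) 0, ∀ x : EuclideanSpace ℝ (Fin 3), ‖u t x‖ ≤ C₀ / (‖x‖ + Real.sqrt (-t))) ∧ ContDiff ℝ 2 U ∧ (∀ t ∈ Set.Ico (-1 : ℝ) 0, ∀ x : EuclideanSpace ℝ (Fin 3), u t x = Literature.Analysis.FluidPDE.pvAnsatz α (fun y _ => U y) t x) ∧ U ≠ 0) → (∀ C₀ : ℝ, 0 < C₀ → ∀ a₀ A₀ : ℝ, 0 < a₀ → a₀ ≤ A₀ → ∀ α : ℝ, a₀ ≤ |α| → |α| ≤ A₀ → ∀ (u : ℝ → EuclideanSpace ℝ (Fin 3) → EuclideanSpace ℝ (Fin 3)) (p : ℝ → EuclideanSpace ℝ (Fin 3) → ℝ) (U : EuclideanSpace ℝ (Fin 3) → EuclideanSpace ℝ (Fin 3)) (m : EuclideanSpace ℝ (Fin 3) → ℝ) (c M₁ : ℝ), Literature.Analysis.FluidPDE.IsClassicalNSSolutionOn (Set.Ico (-1) 0) 1 0 u p → (∀ t ∈ Set.Ico (-1 : ℝ) 0, ∀ x : EuclideanSpace ℝ (Fin 3),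 ‖u t x‖ ≤ C₀ / (‖x‖ + Real.sqrt (-t))) → ContDiff ℝ 2 U → (∀ t ∈ Set.Ico (-1 : ℝ) 0, ∀ x : EuclideanSpace ℝ (Fin 3), u t x = Literature.Analysis.FluidPDE.pvAnsatz α (fun y _ => U y) t x) → 0 < c → 0 < M₁ → (ContDiff ℝ 2 m ∧ (∀ y, 0 < m y) ∧ (∫ y, m y = 1) ∧ (∀ y, c * Real.exp (-(7 / 16 : ℝ) * ‖y‖ ^ 2) ≤ m y) ∧ (∀ y, m y ≤ M₁ * Real.exp (-(1 / 16 : ℝ) * ‖y‖ ^ 2)) ∧ (∃ M₂ : ℝ, ∀ y, ‖fderiv ℝ m y‖ ≤ M₂ * Real.exp (-(1 / 32 : ℝ) * ‖y‖ ^ 2)) ∧ (∀ y, Laplacian.laplacian m y + Literature.Analysis.FluidPDE.VectorCalculus.divergence (fun z => m z • (U z + (1 / 2 : ℝ) • z - α • Literature.Analysis.FluidPDE.rotGen z)) y = 0)) → (∫ y, ‖Literature.Analysis.FluidPDE.curl U y‖ ^ 2 * m y ≤ 4 * α ^ 2) → (∫ y, ‖Literature.Analysis.FluidPDE.curl U y‖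 ^ 2 * m y = 2 * α * ∫ y, (Literature.Analysis.FluidPDE.curl U y) 2 * m y) → U = 0) → Summit.NavierStokesRegularity.NavierStokesRegularity.Theses.TypeICertificateLadder.NoTypeIBlowup := by
  intro hA2 h5
  refine noTypeIBlowup_of_rateClassLiouville fun C hC v hv => ?_
  by_contra hnz
  obtain ⟨C₀, hC₀, α, u, p, U, hns, hI, hU, hA, hU0⟩ := hA2 C hC v hv hnz
  exact hU0 (rssLiouville_of_windowLiouville h5 C₀ hC₀ α u p U hns hI hU hA)

end Summit.NavierStokesRegularity.NavierStokesRegularity.Theorems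

end
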